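import Summits.QuantumFields.YangMills.Theorems.BalabanUVNodesN21KeyedShellWeightShellZero
import Summits.QuantumFields.YangMills.Theorems.BalabanUVNodesSpineReadingOfRecord13CoPHV
import Summits.QuantumFields.YangMills.Theorems.BalabanUVNodesN20KeyedRelWeightSocketAtRecord13CoPH

/-!
# BalabanUVNodes ∕ N20 (NE7b) — LOCATED, KERNEL FORM: THE OVER-CUT END OF THE DIAL IS EXCLUDED.  At a persistence policy cutting DEEPER THAN THE RUN (`K₀ + K < jcut K`)
# the bad class of the spine reading of record is the WHOLE class set — both runs' keys at step `K` are (2.18) sequences of length `K₀ + K`, normalised to `Λ_{K₀+K+1} = ∅`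
# (dag-n20-d's artefact lemma `Node00.keyOldLargeField_seqKey_of_lt`) —, so a `RelWeightBound` there forces the run's TOTAL keyed mass at that step to be `≤ 0` on `|t| ≤ 1`
# (`W K < 1`); the keyed weights of record are `≥ 0` (module `…N21KeyedShellWeightShellZero`), hence they all VANISH; on the LIVE-SELECTOR line E1 identifies that total with the
# dressed partition function of the datum of record, which is POSITIVE (`schemeZ_pos_datumOfRecord₁₃CoPH`) — CONTRADICTION.  So the N20 face of K3⁷ v3 stub 2 FAILS at every
# over-cutting policy on a live tuple, and every cut reading `jc` of a stub-2 witness lives in the WINDOW `jc F θ hP g₀ os K ≤ K` — print's range for `K − j⋆(K)`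

Cell `pub-ymgap` (HUMAN RULING D-0062 Track A; work-bound push D-0149, director-ym №197), width seat `pub-ymgap-dag-n20-w2` (gen 2) on node N20 = NE7b; CLAIM-1 of the
re-seat (pub-ymgap INBOX l.27063), the COMPLEMENT of gen 0's LOCATED-1 `Thm/BalabanUVNodesN20KeyedRelWeightCutZero` (p590852: the LOWER end `jcut = 0` of the dial is FREE) written
the hour plan g81's K3⁷ v3 skeleton (`D81-K3V3/K3Skeleton13SepCoPHv3.lean`, 02f6f498332fdbee, (t-JC): the cut is a PER-TUPLE READING `jc : CutReading`, pin `PinnedAtLive jc sh cr`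
at dag-n20-d's physical-volume reading `crOfRecord₁₃V`) became of record.  Filed `--kind proof --supports stmt-QuantumFields-20544 --as helper` (K3⁷ `SpineGivenEndpointR13SepCoPH`);
COUNT-NEUTRAL; LOCATED (it decides no count and proves no estimate — it says which policies the registered stub text CANNOT be closed at).  [III] = [Balaban1988Convergent],
[LF-II] = [Balaban1989LargeFieldII].

WHY.  Plan g80∕g81's ruling (a) (pub-ymgap INBOX l.25727 ∕ l.26233): the cut policy is the PROVER's DIAL; gen 0 located its free LOWER end (`jcut = 0`: bad class empty, `h20` free,
`hedge` = NE7 on every history) and dag-n20-w3 its monotone INTERIOR (`badKeysSigma_mono_policy`: raising the cut strengthens `h20`, weakens `hedge`).  The UPPER end was only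
asserted on the bus («the all-bad end is excluded by `RelWeightBound.lt_one`», LOCATED-2 l.25984) — this file types it AT THE READING OF RECORD, BY NAME:
* §1 (Node00 level, any torus) `keyOldLargeField_emptyKey` · `keyOldLargeField_twoRunKeyA_of_lt` · `keyOldLargeField_twoRunKeyB_of_lt` (`k < jcut ⇒` both runs' keys are old-bad:
  n20-d's `keyOldLargeField_seqKey_of_lt` on `seqKey s` ∕ `seqKey (truncShift … s')`) · `badKeysSigma_eq_self_of_forall`;
* §2 (the reading) `fst_eq_of_mem_classSet₁₃` · `keyOldLargeField_keyA₁₃_of_lt` · `keyOldLargeField_keyB₁₃_of_lt` (both branches of the total key) · `keyOldLargeField_of_mem_classSet₁₃_of_lt` ·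
  `keyOldLargeField_policy_of_mem_classSet₁₃_of_overCut` (at the key's own policy level `jcut x.1`) ·
  ★ `badClass₁₃_eq_classSet₁₃_of_overCut` (`K₀ + K < jcut K ⇒ badClass₁₃ θ K₀ g₀ jcut K t = classSet₁₃ θ K₀ g₀ K`) · `classSet₁₃_sdiff_badClass₁₃_of_overCut` (the GOOD class is EMPTY:
  N19′'s `NE7.Core` is then VACUOUS at that step — the mirror image of the zero cut);
* §3 (generic `ι`, folklore) `sum_nonpos_of_relWeightBound_of_bad_eq` ∕ `…_right` (`Bad K t = T K`, `|t| ≤ l₀` ⇒ `Σ_{T K} A K t ≤ 0`: `bad_left` with `W K < 1`) ·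
  `not_relWeightBound_of_bad_eq_of_sum_pos`;
* §4 (the carriers of record) ★ `sum_classSet₁₃_weightA_nonpos_of_overCut` ∕ `…weightB…` · `weightA₁₃_eq_zero_of_overCut` ∕ `weightB₁₃_eq_zero_of_overCut` (SELECTOR-FREE: an over-cutting
  N20 witness forces BOTH runs' keyed class weights of record at that step to VANISH identically on `|t| ≤ 1` — gen 0's `weightA₁₃_nonneg` ∕ `weightB₁₃_nonneg`; by dag-n20-w3's
  `weightA₁₃_keyA` that is every run-A (2.18) TERM of the tuple's own expansion) · ★★ `not_relWeightBound_carriers₁₃_of_overCut` (live-selector pin `hsel`, (H-U) `LocalBgMeasurable`,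
  (H-ζ) `ZetaMeasurable`; `0 ≤ ζ` READ OFF `hP` by gen 0's `zeta_nonneg_of_provisos₁₃CoPH`: `(∃ K, K₀ + K < jcut K) ⇒ ¬ RelWeightBound 1 (classSet₁₃ …) (weightA₁₃ …) (weightB₁₃ …)
  (badClass₁₃ … jcut) W` for EVERY `W` — dag-n20-d's E1 `schemeZ_eq_sum_classSet_weightA` at `t = 0` + dag-n20-e∕n27-a's `schemeZ_pos_datumOfRecord₁₃CoPH`) · ★★
  `not_relWeightBound_crOfRecord₁₃VAt_of_overCut` (the reading's OWN N20 face, canonical `W`, physical-volume edition) · `not_relWeightBound_crOfRecord₁₃At_of_overCut` (v1.0 twin);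
* §5 THE WINDOW: ★★ `cutPolicy_le_of_relWeightBound_crOfRecord₁₃VAt` (per live tuple: the N20 face at `crOfRecord₁₃VAt K₀ jcut sh …` ⇒ `∀ K, jcut K ≤ K₀ + K`) · ★★
  `cutReading_le_of_keyedRelWeight_shape_crOfRecord₁₃VAt` (the K3⁷ v3 `KeyedRelWeight` BODY at the per-tuple-cut V reading `fun F θ hP g₀ os ↦ crOfRecord₁₃VAt 0 (jc F θ hP g₀ os) sh …`,
  `N = 2` ⇒ `jc F θ hP g₀ os K ≤ K` at every guarded admissible tuple on the live line under (H-U)∕(H-ζ)) · `cutReading_le_of_pinned_relWeightBound` (the same with the `PinnedAtLive`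
  equation `cr F θ hP g₀ os = crOfRecord₁₃V (jc …) sh …` displayed as a hypothesis — the skeleton's `def`s are not the tree's).
WHAT FOLLOWS FOR THE SKELETON (for plan ∕ the disprover, not decided here): with gen 0's cut-zero file and dag-n20-w3's monotonicity, the N20 conjunct of `stub_expansion13H` is a
statement about a cut reading INSIDE print's window `0 ≤ jc … K ≤ K` ([LF-II] (1.80) p.384: `K − j⋆(K)` with `0 ≤ j⋆(K) ≤ K`): free at the bottom, impossible above the top, the
located NE7b content of record (NOT PRINTED for d = 4, NOT proved) strictly in between — no guard on `jc` is needed to exclude the junk upper end, the face excludes it by itself.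
Cited BY NAME, not re-typed: dag-n20-d `Node00/TwoRunSite{Key,Persistence}` (`seqKey`, `truncShift`, `twoRunKeyA∕B`, `KeyOldLargeField`, `keyOldLargeField_seqKey_of_lt`, `badKeysSigma`,
`mem_badKeysSigma_iff`), `…SpineReadingOfRecord13CoPH(V)` (`keyA₁₃`, `keyB₁₃`, `classSet₁₃`, `weightA∕B₁₃`, `badClass₁₃`, `badClass₁₃_subset`, `crOfRecord₁₃(V)At`, `crOfRecord₁₃V`,
`schemeZ_eq_sum_classSet_weightA∕B`), dag-n20-w1 `…N20KeyedRelWeightSocketAtRecord13CoPH` (`keyA₁₃_mem_classSet₁₃`, `keyB₁₃_mem_classSet₁₃`, `keyB₁₃_fst`), gen 0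
`…N21KeyedShellWeightShellZero` (`zeta_nonneg_of_provisos₁₃CoPH`, `weightA₁₃_nonneg`, `weightB₁₃_nonneg`), dag-n20-e∕n27-a `…N20AtRecord13CoPH.schemeZ_pos_datumOfRecord₁₃CoPH`,
`T4WeightBudget.RelWeightBound` :117.

HONEST FRAMING.  Finite-sum ∕ (2.18)-normalisation bookkeeping; NO weight bounded, NO estimate proved; a located reading of the registered stub text, count-neutral.  It does NOT say
NE7b is false as mathematics — it says the (2.18)-index persistence class at an OVER-CUTTING policy is everything, where no relative weight `< 1` can exist; inside the window the
face is the located NE7b content of record.  Nothing of Bałaban's is asserted; NE7 ∕ NE7b ∕ NE7c NOT PRINTED for `d = 4`, NOT proved; (α)-instance 0∕1; no `Provisos₁₃CoPH`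
inhabitant claimed (K0⁷ OPEN); N19 ∕ N20 ∕ N21 ∕ N27 NOT discharged; K3⁷ NOT closed; counts unmoved (typed 28∕28 · discharged 5∕27); no count claim (the chair's single count line
is the only count).  One finite `𝕋⁴_{L^K}` programme at fixed `ε = L^{−K}`, Bałaban AS PRINTED; the YM mass gap (Clay) is NOT proved by any of this — R4 closes the conditional
finite-𝕋⁴ rung `BalabanLadder.UV` only; NOT ℝ⁴, NOT infinite volume, NOT OS.  No `def`, no `instance`, no `notation`, no `sorry`.  Sources (locators, bookkeeping only): [III] (2.1)
p.254, (2.18) p.257; [LF-II] Thm 1 + (0.1) pp.355–356, (1.80) p.384; [King1986] (3.10)–(3.11) p.656.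
-/

noncomputable section

open scoped BigOperators

namespace Summit.QuantumFields.YangMills.BalabanUVNodes.N20KeyedRelWeightOverCut

open Literature.MathematicalPhysics.QuantumFieldTheory.Balaban1983to89 Literature.MathematicalPhysics.QuantumFieldTheory.Balaban1983to89.Node00
open T4Continuum
open T4WeightBudget (RelWeightBound)
open YMDAG.UVSplit hiding SU
open Summit.QuantumFields.YangMills.Theorems.N20AtRecord13 (schemeZ_pos_datumOfRecord₁₃CoPH)
open Summit.QuantumFields.YangMills.BalabanUVNodes.N20KeyedRelWeightSocketAtRecord13CoPH (keyA₁₃_mem_classSet₁₃ keyB₁₃_mem_classSet₁₃ keyB₁₃_fst)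
open Summit.QuantumFields.YangMills.BalabanUVNodes.N21KeyedShellWeightShellZero (zeta_nonneg_of_provisos₁₃CoPH weightA₁₃_nonneg weightB₁₃_nonneg)

/-! ## §1  Node00 level: a key cut DEEPER THAN ITS LENGTH is old-bad — both runs' keys, and the junk `∅`-key -/

section Keys

variable (F : T4Family)

/-- **THE JUNK `∅`-KEY IS OLD-BAD AT EVERY POSITIVE CUT**: `(∅, ∅)` has `Λ_1 = ∅ ≠ T_η` (the `else`-branch of dag-n20-d's total key `keyB₁₃`, off `0 < θ.τ9.M`).
[cite: Balaban1988Convergent, (2.18) p.257 (bookkeeping)] -/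
theorem keyOldLargeField_emptyKey {α : Type*} [Nonempty α] {jcut : ℕ} (h : 1 ≤ jcut) :
    KeyOldLargeField jcut ((fun _ => ∅, fun _ => ∅) : (ℕ → Set α) × (ℕ → Set α)) :=
  ⟨1, le_rfl, h, Set.empty_ne_univ⟩

/-- **RUN A's KEY OF A (2.18) INDEX OF LENGTH `k` IS OLD-BAD AT EVERY CUT `> k`** (`twoRunKeyA = seqKey`; dag-n20-d's artefact lemma `keyOldLargeField_seqKey_of_lt`: the
normalisation `Λ_{k+1} = ∅`). [cite: Balaban1988Convergent, (2.18) p.257; Balaban1989LargeFieldII, (1.80) p.384 (bookkeeping)] -/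
theorem keyOldLargeField_twoRunKeyA_of_lt (ν : Stage7Numerics) (M : ℕ) (gA : ℕ → ℝ) (K k : ℕ) {jcut : ℕ} (hk : k < jcut) (s : SeqOfRecord F ν M gA K k) :
    KeyOldLargeField jcut (twoRunKeyA F ν M gA K k s) :=
  keyOldLargeField_seqKey_of_lt s hk

/-- **RUN B's BLOCK-DOWN KEY OF A (2.18) INDEX OF LENGTH `k + 1` IS OLD-BAD AT EVERY CUT `> k`** (`twoRunKeyB = seqKey ∘ truncShift`, and `truncShift s'` has length `k`).
[cite: Balaban1988Convergent, (2.18) p.257; Balaban1989LargeFieldII, (1.80) p.384 (bookkeeping)] -/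
theorem keyOldLargeField_twoRunKeyB_of_lt (ν : Stage7Numerics) {M : ℕ} (hM : 0 < M) (gB : ℕ → ℝ) (K k : ℕ) {jcut : ℕ} (hk : k < jcut)
    (s' : SeqOfRecord F ν M gB (K + 1) (k + 1)) : KeyOldLargeField jcut (twoRunKeyB F ν hM gB K k s') :=
  keyOldLargeField_seqKey_of_lt (truncShift F ν hM gB s') hk

/-- A σ-packed class set ALL of whose keys are old-bad at their own policy level IS its bad class. [cite: King1986, (3.10) p.656 (bookkeeping)] -/
theorem badKeysSigma_eq_self_of_forall {K₀ : ℕ} (T : Finset (Σ K, SiteSeqKey F (K₀ + K))) (jcut : ℕ → ℕ)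
    (h : ∀ x ∈ T, KeyOldLargeField (jcut x.1) x.2) : badKeysSigma F T jcut = T :=
  Finset.Subset.antisymm (badKeysSigma_subset F T jcut) fun x hx => (mem_badKeysSigma_iff F T jcut x).2 ⟨hx, h x hx⟩

end Keys

/-! ## §2  At the spine reading of record: an over-cut (`K₀ + K < jcut K`) makes the bad class the WHOLE class set -/

section Reading

variable {F : T4Family} {N : ℕ} [NeZero N] (θ : Stage13HParams F N) (K₀ : ℕ) (g₀ : ℕ → ℝ)

/-- Every key of the class set of record at step `K` sits over the cutoff index `K` (run A: `rfl`; run B: dag-n20-w1's `keyB₁₃_fst`, both branches). [bookkeeping] -/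
theorem fst_eq_of_mem_classSet₁₃ (K : ℕ) {x : Σ K, SiteSeqKey F (K₀ + K)} (hx : x ∈ classSet₁₃ θ K₀ g₀ K) : x.1 = K := by
  letI : ∀ Kc, DecidableEq (SiteSeqKey F Kc) := fun _ => Classical.decEq _
  unfold classSet₁₃ at hx
  rcases Finset.mem_union.1 hx with h | h
  · obtain ⟨s, -, rfl⟩ := Finset.mem_image.1 h
    rfl
  · obtain ⟨s', -, rfl⟩ := Finset.mem_image.1 h
    exact keyB₁₃_fst θ K₀ g₀ K s'

/-- **RUN A's KEY OF RECORD AT STEP `K` IS OLD-BAD AT EVERY CUT `> K₀ + K`** (the index is a (2.18) sequence of length `K₀ + K`). [cite: Balaban1988Convergent, (2.18) p.257 (bookkeeping)] -/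
theorem keyOldLargeField_keyA₁₃_of_lt (K : ℕ) {j : ℕ} (hK : K₀ + K < j) (s : SeqOfRecord F θ.ν θ.τ9.M (histA₁₃ θ K₀ g₀ K) (K₀ + K) (K₀ + K)) :
    KeyOldLargeField j (keyA₁₃ θ K₀ g₀ K s).2 :=
  keyOldLargeField_twoRunKeyA_of_lt F θ.ν θ.τ9.M (histA₁₃ θ K₀ g₀ K) (K₀ + K) (K₀ + K) hK s

/-- **RUN B's KEY OF RECORD AT STEP `K` IS OLD-BAD AT EVERY CUT `> K₀ + K`** — both branches of the total key: the block-down key of a (2.18) sequence of length `K₀ + K + 1`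
(under `0 < θ.τ9.M`), and the junk `∅`-key (off it). [cite: Balaban1988Convergent, (2.18) p.257 (bookkeeping)] -/
theorem keyOldLargeField_keyB₁₃_of_lt (K : ℕ) {j : ℕ} (hK : K₀ + K < j) (s' : SeqOfRecord F θ.ν θ.τ9.M (histB₁₃ θ K₀ g₀ K) (K₀ + K + 1) (K₀ + K + 1)) :
    KeyOldLargeField j (keyB₁₃ θ K₀ g₀ K s').2 := by
  by_cases hM : 0 < θ.τ9.M
  · rw [keyB₁₃_eq θ K₀ g₀ hM K s']
    exact keyOldLargeField_twoRunKeyB_of_lt F θ.ν hM (histB₁₃ θ K₀ g₀ K) (K₀ + K) (K₀ + K) hK s'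
  · have h0 : keyB₁₃ θ K₀ g₀ K s' = ⟨K, (fun _ => ∅, fun _ => ∅)⟩ := by
      unfold keyB₁₃
      rw [dif_neg hM]
    rw [h0]
    exact keyOldLargeField_emptyKey (by omega)

/-- **EVERY KEY OF THE CLASS SET OF RECORD AT STEP `K` IS OLD-BAD AT EVERY CUT `> K₀ + K`.** [cite: Balaban1988Convergent, (2.18) p.257 (bookkeeping)] -/
theorem keyOldLargeField_of_mem_classSet₁₃_of_lt (K : ℕ) {j : ℕ} (hK : K₀ + K < j) {x : Σ K, SiteSeqKey F (K₀ + K)} (hx : x ∈ classSet₁₃ θ K₀ g₀ K) :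
    KeyOldLargeField j x.2 := by
  letI : ∀ Kc, DecidableEq (SiteSeqKey F Kc) := fun _ => Classical.decEq _
  unfold classSet₁₃ at hx
  rcases Finset.mem_union.1 hx with h | h
  · obtain ⟨s, -, rfl⟩ := Finset.mem_image.1 h
    exact keyOldLargeField_keyA₁₃_of_lt θ K₀ g₀ K hK s
  · obtain ⟨s', -, rfl⟩ := Finset.mem_image.1 h
    exact keyOldLargeField_keyB₁₃_of_lt θ K₀ g₀ K hK s'

/-- **… AT THE KEY's OWN POLICY LEVEL** (the form `badKeysSigma` reads: the level is `jcut x.1`, and `x.1 = K` on the class set at step `K`): `K₀ + K < jcut K ⇒` every key of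
`classSet₁₃ θ K₀ g₀ K` is old-bad at `jcut x.1`. [cite: Balaban1988Convergent, (2.18) p.257; Balaban1989LargeFieldII, (1.80) p.384 (bookkeeping)] -/
theorem keyOldLargeField_policy_of_mem_classSet₁₃_of_overCut (jcut : ℕ → ℕ) (K : ℕ) (hK : K₀ + K < jcut K) {x : Σ K, SiteSeqKey F (K₀ + K)}
    (hx : x ∈ classSet₁₃ θ K₀ g₀ K) : KeyOldLargeField (jcut x.1) x.2 := by
  letI : ∀ Kc, DecidableEq (SiteSeqKey F Kc) := fun _ => Classical.decEq _
  unfold classSet₁₃ at hx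
  rcases Finset.mem_union.1 hx with h | h
  · obtain ⟨s, -, rfl⟩ := Finset.mem_image.1 h
    exact keyOldLargeField_keyA₁₃_of_lt θ K₀ g₀ K hK s
  · obtain ⟨s', -, rfl⟩ := Finset.mem_image.1 h
    by_cases hM : 0 < θ.τ9.M
    · rw [keyB₁₃_eq θ K₀ g₀ hM K s']
      exact keyOldLargeField_twoRunKeyB_of_lt F θ.ν hM (histB₁₃ θ K₀ g₀ K) (K₀ + K) (K₀ + K) hK s'
    · have h0 : keyB₁₃ θ K₀ g₀ K s' = ⟨K, (fun _ => ∅, fun _ => ∅)⟩ := by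
        unfold keyB₁₃
        rw [dif_neg hM]
      rw [h0]
      exact keyOldLargeField_emptyKey (jcut := jcut K) (by omega)

/-- **★ AT AN OVER-CUTTING POLICY THE BAD CLASS OF RECORD IS THE WHOLE CLASS SET**: `K₀ + K < jcut K ⇒ badClass₁₃ θ K₀ g₀ jcut K t = classSet₁₃ θ K₀ g₀ K` for every source `t`.
[cite: Balaban1989LargeFieldII, (1.80) p.384; King1986, (3.10) p.656 (bookkeeping)] -/
theorem badClass₁₃_eq_classSet₁₃_of_overCut (jcut : ℕ → ℕ) (K : ℕ) (t : ℝ) (hK : K₀ + K < jcut K) :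
    badClass₁₃ θ K₀ g₀ jcut K t = classSet₁₃ θ K₀ g₀ K :=
  badKeysSigma_eq_self_of_forall F _ jcut fun _ hx => keyOldLargeField_policy_of_mem_classSet₁₃_of_overCut θ K₀ g₀ jcut K hK hx

/-- **… SO THE GOOD CLASS OF RECORD IS EMPTY THERE**: N19′'s `NE7.Core` ∕ `hedge` at that step constrains nothing — the over-cut is the junk end for the CORE face exactly as
the zero cut is the free end for the WEIGHT face (gen 0's `classSet₁₃_sdiff_badClass₁₃_cutZero`). [cite: King1986, (3.10) p.656 (bookkeeping)] -/
theorem classSet₁₃_sdiff_badClass₁₃_of_overCut [DecidableEq (Σ K, SiteSeqKey F (K₀ + K))] (jcut : ℕ → ℕ) (K : ℕ) (t : ℝ) (hK : K₀ + K < jcut K) :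
    classSet₁₃ θ K₀ g₀ K \ badClass₁₃ θ K₀ g₀ jcut K t = ∅ := by
  rw [badClass₁₃_eq_classSet₁₃_of_overCut θ K₀ g₀ jcut K t hK, Finset.sdiff_self]

end Reading

/-! ## §3  Folklore: what a `RelWeightBound` forces at a step where the bad class is EVERYTHING -/

section Generic

variable {ι : Type*} {l₀ : ℝ} {T : ℕ → Finset ι} {A B : ℕ → ℝ → ι → ℝ} {Bad : ℕ → ℝ → Finset ι} {W : ℕ → ℝ}

/-- **`Bad K t = T K` UNDER A `RelWeightBound` FORCES RUN A's TOTAL AT `(K, t)` TO BE `≤ 0`**: `Σ_T A ≤ W K · Σ_T A` with `W K < 1`. [cite: King1986, (3.10)–(3.11) p.656 (bookkeeping)] -/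
theorem sum_nonpos_of_relWeightBound_of_bad_eq (hW : RelWeightBound l₀ T A B Bad W) {K : ℕ} {t : ℝ} (ht : |t| ≤ l₀) (h : Bad K t = T K) :
    ∑ τ ∈ T K, A K t τ ≤ 0 := by
  have h₁ := hW.bad_left K t ht
  rw [h] at h₁
  have h₂ := hW.lt_one K
  nlinarith

/-- **… AND RUN B's.** [cite: King1986, (3.10)–(3.11) p.656 (bookkeeping)] -/
theorem sum_nonpos_of_relWeightBound_of_bad_eq_right (hW : RelWeightBound l₀ T A B Bad W) {K : ℕ} {t : ℝ} (ht : |t| ≤ l₀) (h : Bad K t = T K) :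
    ∑ τ ∈ T K, B K t τ ≤ 0 := by
  have h₁ := hW.bad_right K t ht
  rw [h] at h₁
  have h₂ := hW.lt_one K
  nlinarith

/-- **HENCE A CLASS THAT IS EVERYTHING AT ONE ADMISSIBLE `(K, t)` WITH POSITIVE RUN-A TOTAL ADMITS NO `RelWeightBound`, WHATEVER `W`** (the single-step form of
`T4BadClassBooking.not_relWeightBound_of_saturated` at level `c = 1`). [cite: King1986, (3.10)–(3.11) p.656 (bookkeeping)] -/
theorem not_relWeightBound_of_bad_eq_of_sum_pos {K : ℕ} {t : ℝ} (ht : |t| ≤ l₀) (h : Bad K t = T K) (hpos : 0 < ∑ τ ∈ T K, A K t τ) (W : ℕ → ℝ) :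
    ¬ RelWeightBound l₀ T A B Bad W :=
  fun hW => not_lt.2 (sum_nonpos_of_relWeightBound_of_bad_eq hW ht h) hpos

end Generic

/-! ## §4  At the carriers of record: an over-cutting N20 witness kills the run's keyed mass — and, on the live line, contradicts E1 -/

section Carriers

variable {F : T4Family} {N : ℕ} [NeZero N] (θ : Stage13HParams F N) (hP : θ.Provisos₁₃CoPH F N) (K₀ : ℕ) (g₀ : ℕ → ℝ) (os : List (ULoop F))

/-- **★ AN OVER-CUTTING N20 WITNESS FORCES RUN A's TOTAL KEYED MASS OF RECORD AT THAT STEP TO BE `≤ 0` ON `|t| ≤ 1`** (selector-free; §2 + §3). [cite: King1986, (3.10)–(3.11) p.656; Balaban1989LargeFieldII, (1.80) p.384 (bookkeeping)] -/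
theorem sum_classSet₁₃_weightA_nonpos_of_overCut {jcut : ℕ → ℕ} {W : ℕ → ℝ}
    (hW : RelWeightBound 1 (classSet₁₃ θ K₀ g₀) (weightA₁₃ θ hP K₀ g₀ os) (weightB₁₃ θ hP K₀ g₀ os) (badClass₁₃ θ K₀ g₀ jcut) W)
    {K : ℕ} (hK : K₀ + K < jcut K) {t : ℝ} (ht : |t| ≤ 1) :
    ∑ x ∈ classSet₁₃ θ K₀ g₀ K, weightA₁₃ θ hP K₀ g₀ os K t x ≤ 0 :=
  sum_nonpos_of_relWeightBound_of_bad_eq hW ht (badClass₁₃_eq_classSet₁₃_of_overCut θ K₀ g₀ jcut K t hK)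

/-- **★ … AND RUN B's.** [cite: King1986, (3.10)–(3.11) p.656; Balaban1989LargeFieldII, (1.80) p.384 (bookkeeping)] -/
theorem sum_classSet₁₃_weightB_nonpos_of_overCut {jcut : ℕ → ℕ} {W : ℕ → ℝ}
    (hW : RelWeightBound 1 (classSet₁₃ θ K₀ g₀) (weightA₁₃ θ hP K₀ g₀ os) (weightB₁₃ θ hP K₀ g₀ os) (badClass₁₃ θ K₀ g₀ jcut) W)
    {K : ℕ} (hK : K₀ + K < jcut K) {t : ℝ} (ht : |t| ≤ 1) :
    ∑ x ∈ classSet₁₃ θ K₀ g₀ K, weightB₁₃ θ hP K₀ g₀ os K t x ≤ 0 :=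
  sum_nonpos_of_relWeightBound_of_bad_eq_right hW ht (badClass₁₃_eq_classSet₁₃_of_overCut θ K₀ g₀ jcut K t hK)

/-- **EVERY RUN-A KEYED CLASS WEIGHT OF RECORD AT THAT STEP VANISHES** (the weights are `≥ 0` at a tuple with core provisos — gen 0's `weightA₁₃_nonneg` — and their sum is `≤ 0`):
an over-cutting N20 witness says the tuple's own run-A (2.18) expansion at step `K` is IDENTICALLY ZERO on `|t| ≤ 1` (term by term through dag-n20-w3's `weightA₁₃_keyA`).
[cite: Balaban1988Convergent, (2.18) p.257; King1986, (3.10)–(3.11) p.656 (bookkeeping)] -/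
theorem weightA₁₃_eq_zero_of_overCut {jcut : ℕ → ℕ} {W : ℕ → ℝ}
    (hW : RelWeightBound 1 (classSet₁₃ θ K₀ g₀) (weightA₁₃ θ hP K₀ g₀ os) (weightB₁₃ θ hP K₀ g₀ os) (badClass₁₃ θ K₀ g₀ jcut) W)
    {K : ℕ} (hK : K₀ + K < jcut K) {t : ℝ} (ht : |t| ≤ 1) :
    ∀ x ∈ classSet₁₃ θ K₀ g₀ K, weightA₁₃ θ hP K₀ g₀ os K t x = 0 :=
  (Finset.sum_eq_zero_iff_of_nonneg fun x _ => weightA₁₃_nonneg F θ hP K₀ g₀ os K t x).1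
    (le_antisymm (sum_classSet₁₃_weightA_nonpos_of_overCut θ hP K₀ g₀ os hW hK ht) (Finset.sum_nonneg fun x _ => weightA₁₃_nonneg F θ hP K₀ g₀ os K t x))

/-- **… AND EVERY RUN-B KEYED CLASS WEIGHT OF RECORD** (gen 0's `weightB₁₃_nonneg`). [cite: Balaban1988Convergent, (2.18) p.257; King1986, (3.10)–(3.11) p.656 (bookkeeping)] -/
theorem weightB₁₃_eq_zero_of_overCut {jcut : ℕ → ℕ} {W : ℕ → ℝ}
    (hW : RelWeightBound 1 (classSet₁₃ θ K₀ g₀) (weightA₁₃ θ hP K₀ g₀ os) (weightB₁₃ θ hP K₀ g₀ os) (badClass₁₃ θ K₀ g₀ jcut) W)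
    {K : ℕ} (hK : K₀ + K < jcut K) {t : ℝ} (ht : |t| ≤ 1) :
    ∀ x ∈ classSet₁₃ θ K₀ g₀ K, weightB₁₃ θ hP K₀ g₀ os K t x = 0 :=
  (Finset.sum_eq_zero_iff_of_nonneg fun x _ => weightB₁₃_nonneg F θ hP K₀ g₀ os K t x).1
    (le_antisymm (sum_classSet₁₃_weightB_nonpos_of_overCut θ hP K₀ g₀ os hW hK ht) (Finset.sum_nonneg fun x _ => weightB₁₃_nonneg F θ hP K₀ g₀ os K t x))

variable (E : B12.RunParams → ℝ)

/-- **★★ ON THE LIVE-SELECTOR LINE NO `RelWeightBound` EXISTS AT THE CARRIERS OF RECORD WITH AN OVER-CUTTING POLICY — FOR NO WEIGHT SEQUENCE `W`.**  Under the pin `hsel` and the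
laws (H-U) `LocalBgMeasurable` ∕ (H-ζ) `ZetaMeasurable` (the third law `0 ≤ ζ` is read off `hP`), dag-n20-d's E1 identifies run A's total keyed mass at step `K` with the dressed
partition function `schemeZ ((datumOfRecord₁₃CoPH F N θ hP).scheme g₀) os (K₀ + K) 0`, which is POSITIVE (`schemeZ_pos_datumOfRecord₁₃CoPH`, hypothesis-free) — against §4's `≤ 0`.
[cite: Balaban1988Convergent, (2.18) p.257; Balaban1989LargeFieldII, Thm 1 + (0.1) pp.355–356, (1.80) p.384; King1986, (3.10)–(3.11) p.656 (bookkeeping)] -/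
theorem not_relWeightBound_carriers₁₃_of_overCut (hsel : θ.ppSel = ppSelLiveOfRecord F N θ.ν θ.τ9 E (wOfRecord₉ F N θ.toStage9Params))
    (hU : LocalBgMeasurable F N θ.ν) (hζm : ZetaMeasurable F N θ.ζ) {jcut : ℕ → ℕ} (hK : ∃ K, K₀ + K < jcut K) (W : ℕ → ℝ) :
    ¬ RelWeightBound 1 (classSet₁₃ θ K₀ g₀) (weightA₁₃ θ hP K₀ g₀ os) (weightB₁₃ θ hP K₀ g₀ os) (badClass₁₃ θ K₀ g₀ jcut) W := by
  rintro hW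
  obtain ⟨K, hK⟩ := hK
  have h0 := sum_classSet₁₃_weightA_nonpos_of_overCut θ hP K₀ g₀ os hW hK (t := 0) (by rw [abs_zero]; exact zero_le_one)
  have hpos := schemeZ_pos_datumOfRecord₁₃CoPH θ hP g₀ os (K₀ + K) 0
  rw [schemeZ_eq_sum_classSet_weightA K₀ θ hP E hsel hU hζm (zeta_nonneg_of_provisos₁₃CoPH F θ hP) g₀ os K 0] at hpos
  exact not_lt.2 h0 hpos

/-- **★★ THE READING's OWN N20 FACE FAILS AT AN OVER-CUTTING POLICY ON A LIVE TUPLE** (physical-volume edition `crOfRecord₁₃VAt`, canonical `W = wInf …`; any shell split `sh`).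
[cite: Balaban1989LargeFieldII, Thm 1 + (0.1) pp.355–356, (1.80) p.384; King1986, (3.10)–(3.11) p.656 (bookkeeping)] -/
theorem not_relWeightBound_crOfRecord₁₃VAt_of_overCut (sh : ShellSplit₁₃CoPH N K₀)
    (hsel : θ.ppSel = ppSelLiveOfRecord F N θ.ν θ.τ9 E (wOfRecord₉ F N θ.toStage9Params)) (hU : LocalBgMeasurable F N θ.ν) (hζm : ZetaMeasurable F N θ.ζ)
    {jcut : ℕ → ℕ} (hK : ∃ K, K₀ + K < jcut K) :
    ¬ RelWeightBound (crOfRecord₁₃VAt K₀ jcut sh F θ hP g₀ os).l₀ (crOfRecord₁₃VAt K₀ jcut sh F θ hP g₀ os).T (crOfRecord₁₃VAt K₀ jcut sh F θ hP g₀ os).A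
      (crOfRecord₁₃VAt K₀ jcut sh F θ hP g₀ os).B (crOfRecord₁₃VAt K₀ jcut sh F θ hP g₀ os).Bad (crOfRecord₁₃VAt K₀ jcut sh F θ hP g₀ os).W :=
  not_relWeightBound_carriers₁₃_of_overCut θ hP K₀ g₀ os E hsel hU hζm hK _

/-- **THE v1.0 TWIN** (`crOfRecord₁₃At`, `vol := 1`; the N20 face does not read `vol`). [cite: Balaban1989LargeFieldII, (1.80) p.384; King1986, (3.10)–(3.11) p.656 (bookkeeping)] -/
theorem not_relWeightBound_crOfRecord₁₃At_of_overCut (sh : ShellSplit₁₃CoPH N K₀)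
    (hsel : θ.ppSel = ppSelLiveOfRecord F N θ.ν θ.τ9 E (wOfRecord₉ F N θ.toStage9Params)) (hU : LocalBgMeasurable F N θ.ν) (hζm : ZetaMeasurable F N θ.ζ)
    {jcut : ℕ → ℕ} (hK : ∃ K, K₀ + K < jcut K) :
    ¬ RelWeightBound (crOfRecord₁₃At K₀ jcut sh F θ hP g₀ os).l₀ (crOfRecord₁₃At K₀ jcut sh F θ hP g₀ os).T (crOfRecord₁₃At K₀ jcut sh F θ hP g₀ os).A
      (crOfRecord₁₃At K₀ jcut sh F θ hP g₀ os).B (crOfRecord₁₃At K₀ jcut sh F θ hP g₀ os).Bad (crOfRecord₁₃At K₀ jcut sh F θ hP g₀ os).W :=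
  not_relWeightBound_carriers₁₃_of_overCut θ hP K₀ g₀ os E hsel hU hζm hK _

/-! ## §5  THE WINDOW: on a live tuple every N20 witness cuts inside `[0, K₀ + K]` -/

/-- **★★ THE DIAL's RANGE IS THE WINDOW.**  If the N20 face holds at `crOfRecord₁₃VAt K₀ jcut sh` at a tuple on the live-selector line under (H-U) ∕ (H-ζ), then the policy never
cuts deeper than the run: `jcut K ≤ K₀ + K` for EVERY `K` — print's range `K − j⋆(K) ∈ [0, K]` for the persistence depth, with gen 0's free end `0` at the bottom.
[cite: Balaban1989LargeFieldII, (1.80) p.384; King1986, (3.10)–(3.11) p.656 (bookkeeping)] -/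
theorem cutPolicy_le_of_relWeightBound_crOfRecord₁₃VAt (sh : ShellSplit₁₃CoPH N K₀)
    (hsel : θ.ppSel = ppSelLiveOfRecord F N θ.ν θ.τ9 E (wOfRecord₉ F N θ.toStage9Params)) (hU : LocalBgMeasurable F N θ.ν) (hζm : ZetaMeasurable F N θ.ζ)
    {jcut : ℕ → ℕ}
    (h20 : RelWeightBound (crOfRecord₁₃VAt K₀ jcut sh F θ hP g₀ os).l₀ (crOfRecord₁₃VAt K₀ jcut sh F θ hP g₀ os).T (crOfRecord₁₃VAt K₀ jcut sh F θ hP g₀ os).A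
      (crOfRecord₁₃VAt K₀ jcut sh F θ hP g₀ os).B (crOfRecord₁₃VAt K₀ jcut sh F θ hP g₀ os).Bad (crOfRecord₁₃VAt K₀ jcut sh F θ hP g₀ os).W)
    (K : ℕ) : jcut K ≤ K₀ + K :=
  not_lt.1 fun hK => not_relWeightBound_crOfRecord₁₃VAt_of_overCut θ hP K₀ g₀ os E sh hsel hU hζm ⟨K, hK⟩ h20

/-- **THE v1.0 TWIN OF THE WINDOW.** [cite: Balaban1989LargeFieldII, (1.80) p.384; King1986, (3.10)–(3.11) p.656 (bookkeeping)] -/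
theorem cutPolicy_le_of_relWeightBound_crOfRecord₁₃At (sh : ShellSplit₁₃CoPH N K₀)
    (hsel : θ.ppSel = ppSelLiveOfRecord F N θ.ν θ.τ9 E (wOfRecord₉ F N θ.toStage9Params)) (hU : LocalBgMeasurable F N θ.ν) (hζm : ZetaMeasurable F N θ.ζ)
    {jcut : ℕ → ℕ}
    (h20 : RelWeightBound (crOfRecord₁₃At K₀ jcut sh F θ hP g₀ os).l₀ (crOfRecord₁₃At K₀ jcut sh F θ hP g₀ os).T (crOfRecord₁₃At K₀ jcut sh F θ hP g₀ os).A
      (crOfRecord₁₃At K₀ jcut sh F θ hP g₀ os).B (crOfRecord₁₃At K₀ jcut sh F θ hP g₀ os).Bad (crOfRecord₁₃At K₀ jcut sh F θ hP g₀ os).W)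
    (K : ℕ) : jcut K ≤ K₀ + K :=
  not_lt.1 fun hK => not_relWeightBound_crOfRecord₁₃At_of_overCut θ hP K₀ g₀ os E sh hsel hU hζm ⟨K, hK⟩ h20

end Carriers

/-! ## §6  The K3⁷ v3 binder shapes (`N = 2`): a `KeyedRelWeight` witness at the per-tuple-cut V reading of record cuts inside the window at every live tuple -/

section Shapes

/-- **★★ THE K3⁷ v3 `KeyedRelWeight` BODY AT THE PER-TUPLE-CUT V READING OF RECORD CONSTRAINS THE CUT READING TO THE WINDOW.**  IF the body of `KeyedRelWeight cr` holds for the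
reading `cr := fun F θ hP g₀ os ↦ crOfRecord₁₃VAt 0 (jc F θ hP g₀ os) sh F θ hP g₀ os` (the (t-JC) pin shape; the skeleton's `def` is not the tree's, so the body is spelled out),
THEN at every guarded admissible Stage-13 tuple with core provisos ON THE LIVE-SELECTOR LINE (`LiveSel F θ` spelled out) under (H-U) ∕ (H-ζ), every `g₀`, `os`, `K`:
`jc F θ hP g₀ os K ≤ K`.  LOCATED: no guard on `jc` is needed in the stub to exclude the junk upper end of the dial — the face excludes it by itself.
[cite: Balaban1989LargeFieldII, Thm 1 + (0.1) pp.355–356, (1.80) p.384; King1986, (3.10)–(3.11) p.656 (bookkeeping)] -/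
theorem cutReading_le_of_keyedRelWeight_shape_crOfRecord₁₃VAt
    (jc : (F : T4Family) → (θ : Stage13HParams F 2) → θ.Provisos₁₃CoPH F 2 → (ℕ → ℝ) → List (ULoop F) → ℕ → ℕ) (sh : ShellSplit₁₃CoPH 2 0)
    (h20 : ∀ (F : T4Family) (θ : Stage13HParams F 2) (hP : θ.Provisos₁₃CoPH F 2), (θ.ZhUnity F 2 ∧ θ.SlotsNondegenerate₁₃ F 2) → θ.Admissible F 2 →
      ∀ (g₀ : ℕ → ℝ) (os : List (ULoop F)),
        RelWeightBound (crOfRecord₁₃VAt 0 (jc F θ hP g₀ os) sh F θ hP g₀ os).l₀ (crOfRecord₁₃VAt 0 (jc F θ hP g₀ os) sh F θ hP g₀ os).T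
          (crOfRecord₁₃VAt 0 (jc F θ hP g₀ os) sh F θ hP g₀ os).A (crOfRecord₁₃VAt 0 (jc F θ hP g₀ os) sh F θ hP g₀ os).B
          (crOfRecord₁₃VAt 0 (jc F θ hP g₀ os) sh F θ hP g₀ os).Bad (crOfRecord₁₃VAt 0 (jc F θ hP g₀ os) sh F θ hP g₀ os).W)
    {F : T4Family} (θ : Stage13HParams F 2) (hP : θ.Provisos₁₃CoPH F 2) (hU : θ.ZhUnity F 2 ∧ θ.SlotsNondegenerate₁₃ F 2) (hθ : θ.Admissible F 2)
    (hsel : θ.ppSel = ppSelLiveOfRecord F 2 θ.ν θ.τ9 (EOfRecord₁₃ F 2 θ.toStage13Params) (wOfRecord₉ F 2 θ.toStage9Params))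
    (hbg : LocalBgMeasurable F 2 θ.ν) (hζm : ZetaMeasurable F 2 θ.ζ) (g₀ : ℕ → ℝ) (os : List (ULoop F)) (K : ℕ) :
    jc F θ hP g₀ os K ≤ K := by
  simpa only [Nat.zero_add] using
    cutPolicy_le_of_relWeightBound_crOfRecord₁₃VAt θ hP 0 g₀ os _ sh hsel hbg hζm (h20 F θ hP hU hθ g₀ os) K

/-- **THE SAME WITH THE `PinnedAtLive` EQUATION DISPLAYED**: for ANY reading `cr : SpineReading₁₃CoPH 2` which at the live tuple IS `crOfRecord₁₃V (jc F θ hP g₀ os) sh` there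
(the skeleton's pin, as a hypothesis) and carries the N20 face there, the cut reading at that tuple lies in the window.  This is the form a stub-2 witness `⟨jc, sh, cr, hpin, h20, …⟩`
meets tuple by tuple. [cite: Balaban1989LargeFieldII, Thm 1 + (0.1) pp.355–356, (1.80) p.384; King1986, (3.10)–(3.11) p.656 (bookkeeping)] -/
theorem cutReading_le_of_pinned_relWeightBound
    (jc : (F : T4Family) → (θ : Stage13HParams F 2) → θ.Provisos₁₃CoPH F 2 → (ℕ → ℝ) → List (ULoop F) → ℕ → ℕ) (sh : ShellSplit₁₃CoPH 2 0) (cr : SpineReading₁₃CoPH 2)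
    {F : T4Family} (θ : Stage13HParams F 2) (hP : θ.Provisos₁₃CoPH F 2) (g₀ : ℕ → ℝ) (os : List (ULoop F))
    (hpin : cr F θ hP g₀ os = crOfRecord₁₃V (jc F θ hP g₀ os) sh F θ hP g₀ os)
    (h20 : RelWeightBound (cr F θ hP g₀ os).l₀ (cr F θ hP g₀ os).T (cr F θ hP g₀ os).A (cr F θ hP g₀ os).B (cr F θ hP g₀ os).Bad (cr F θ hP g₀ os).W)
    (hsel : θ.ppSel = ppSelLiveOfRecord F 2 θ.ν θ.τ9 (EOfRecord₁₃ F 2 θ.toStage13Params) (wOfRecord₉ F 2 θ.toStage9Params))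
    (hbg : LocalBgMeasurable F 2 θ.ν) (hζm : ZetaMeasurable F 2 θ.ζ) (K : ℕ) :
    jc F θ hP g₀ os K ≤ K := by
  rw [hpin] at h20
  simpa only [Nat.zero_add] using cutPolicy_le_of_relWeightBound_crOfRecord₁₃VAt θ hP 0 g₀ os _ sh hsel hbg hζm h20 K

end Shapes

end Summit.QuantumFields.YangMills.BalabanUVNodes.N20KeyedRelWeightOverCut

end
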